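import Summits.QuantumFields.YangMills.Theorems.BalabanUVNodesN09TowerOfNumericsAtRecord
import Summits.QuantumFields.YangMills.Theorems.BalabanUVNodesN09WindowRadiusOfRecord

/-!
# BalabanUVNodes ∕ N09 — THE `α`-FREE EDITION OF ROAD A′: N09's analytic inclusion `hreg_j ∧ (F3)_j` for all `j < K`, and the Theorem-3 door at the Stage-13 record,
# displaying ONLY numerics in `(εreg, ε₂₉, ε₀; d, L, N)` + `hsolν hcrit hU` (+ the door's (181)ˢᵒˡ `hcov`, [B11] ×3, `εreg = εbg`) — no auxiliary window radius

Cell `pub-ymgap` (YM-PLAN Track A), width seat `pub-ymgap-dag-n09-w4` g6 (FILE 2 = INTENT-2); count-neutral helper of K1⁹ `StabilityBRunRowsAtRecordR13SepCoPHV` =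
stmt-QuantumFields-27364 (`--supports`, `--as helper`).  [I] = [Balaban1987RG1] (CMP 109).

WHAT.  dag-n09-w5 g5's last plug `…N09TowerOfNumericsAtRecord` (FILE 4 of that seat) runs road A′'s (F1) tower and dag-n09-w4 g3's Theorem-3 door from numerics + `hsolν hcrit hU`,
still displaying the AUXILIARY radius `α` of the private-coordinate road through `0 ≤ α ≤ 1∕24`, `64·α ≤ δ_N`, `157·α < L^{−(d−1)}`, `hgap : offCard c∕|Idx| + 150·α < 1`
(every level, every coarse bond) and the STRICT margin `(((d+2)L)²∕4)·ε₀ < α`.  FILE 1 `…N09WindowRadiusOfRecord` showed: `hgap` is a theorem of `157·α < L^{−(d−1)}`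
(`offCard c∕|Idx| = 1 − L^{−(d−1)}`), and the `α`-package is inhabited iff the margin `m = (((d+2)L)²∕4)·ε₀` satisfies `m < 1∕24`, `64·m < δ_N`, `157·m < (L^{d−1})⁻¹`
(`exists_windowRadius_of_ε₀`).  THIS FILE is the one-`obtain` composition: both theorems of dag-n09-w5's FILE 4 with the six `α`-clauses REPLACED by those three `ε₀`-lines.

WHAT IS PROVED (theorems only; 0 def, 0 instance, 0 notation, 0 sorry).  ★★★ `hreg_pos_all_of_hsolν_of_numerics_alphaFree` (generic Stage-13 parameter `θ₀`, torus `K`,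
history `g`) · ★★★ `thm3Member_stage13SepCoPH_atDomAlt_of_hsolν_of_numerics_of_εreg_eq_alphaFree` (at the Stage-13 record `(θ, h, w, P)`).

DISPLAYED after this file (what road A′'s `hreg` costs; every item a number or another lane's letter): `0 < εreg`, `hε3`, `hε2`, `0 < ε₂₉`, `hn1`, `hn2`, `hord`, `0 ≤ ε₀`, the
three `ε₀`-lines, `((d·L)²∕4)·ε₀ < δ_Fed` (jointly inhabited: FILE 1 `numerics_inhabited` — which says nothing about the numerics OF RECORD); [B11]-existence `hsolν`; N07's
`hcrit`; (H-U) `hU`; for the door also (181)ˢᵒˡ `hcov`, [B11] ×3 at `εbg` (`h11 hres huniq`), `εreg = εbg`, `hC`.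

HONEST FRAMING.  A COMPOSITION BY NAME (count-neutral); the analysis consumed lives in the cited files of dag-n09-w1∕w3∕w4∕w5∕w6 and N07's lanes; nothing of Bałaban's
estimates asserted; no numerics row OF RECORD is claimed to meet the lines (K0-numerics lane); `hreg` RE-SHAPED to those letters, NOT discharged at the record; N09 NOT
discharged; conjunct 1 (Lemma 4) ∕ FLAG №7 untouched; K0⁷ ∕ K1⁹ ∕ K3⁸ NOT closed; counts unmoved (typed 28∕28 · discharged 5∕28); no summit statement is proved here; one
finite four-torus programme at fixed `ε = L^{−K}` per run — R4 closes the conditional rung `BalabanLadder.UV` only; NOT continuum ∕ ℝ⁴ ∕ infinite volume ∕ OS; the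
Yang–Mills mass gap (Clay) is NOT proved by any of this.
-/

noncomputable section

namespace Summit.QuantumFields.YangMills.BalabanUVNodes.N09TowerOfNumericsAlphaFree

open MeasureTheory Set Function Filter Topology
open scoped ENNReal NNReal
open Literature.MathematicalPhysics.QuantumFieldTheory.Balaban1983to89
open Literature.MathematicalPhysics.QuantumFieldTheory.Balaban1983to89.T4Continuum (T4Family)
open Literature.MathematicalPhysics.QuantumFieldTheory.Balaban1983to89.Node00
open Literature.MathematicalPhysics.QuantumFieldTheory.Balaban1983to89.ExpMeanLog (deltaSU)
open Literature.MathematicalPhysics.QuantumFieldTheory.Balaban1983to89.FederbushMean (deltaFed)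
open Literature.MathematicalPhysics.QuantumFieldTheory.Balaban1983to89.DagBinding (WorldP leavesP)
open Literature.MathematicalPhysics.QuantumFieldTheory.Balaban1983to89.B12RTGaugeInvariance254 (liftTransf)
open Literature.MathematicalPhysics.QuantumFieldTheory.Balaban1983to89.GaugeField (gaugeAct)
open N09TowerOfNumericsAtRecord (hreg_pos_all_of_hsolν_of_numerics thm3Member_stage13SepCoPH_atDomAlt_of_hsolν_of_numerics_of_εreg_eq)
open N09WindowRadiusOfRecord (exists_windowRadius_of_ε₀)
open N09B0RiderAtRecord (thm3Member_stage13SepCoPH_atDomAlt_of_thm1_of_reg8_of_numerics)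
open N09BackgroundRadiiTransfer (ukExists_εreg_of_h11_of_reg8)
open Literature.MathematicalPhysics.QuantumFieldTheory.Balaban1983to89.B12NodeKnitRecord13SepCoPH (integrable_betaInput_stage13_of_measurableUk)

variable {F : T4Family} {N : ℕ} [NeZero N]

/-- ★★★ **ROAD A′'s (F1) TOWER, `α`-FREE**: at a Stage-13 parameter `θ₀`, torus `K`, history `g` — for every `j < K`, `domAlt_{j+1} ⊆ regSetOfRecord K j ρ_j` (N09's `hreg_j`)
and `T_jρ_j > 0` on `domAlt_{j+1}` ((F3)_j) — from numerics in `(εreg, ε₂₉, ε₀; d, L, N)` ONLY (dag-n09-w4 g3's seven, `0 ≤ ε₀`, the three `ε₀`-lines of FILE 1,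
`((d·L)²∕4)·ε₀ < δ_Fed`) + [B11]-existence `hsolν` + N07's `hcrit` + (H-U) `hU`.  dag-n09-w5's `hreg_pos_all_of_hsolν_of_numerics` at the radius of `exists_windowRadius_of_ε₀`.
CONDITIONAL; nothing of Bałaban's asserted; `hreg` NOT discharged at the record.
[cite: Balaban1987RG1, p.259, (0.4) p.253, (0.19) p.255, (2.9)–(2.10) pp.266–267; Balaban1985Variational, Thm 1 (8)–(10) p.279; Balaban1985Averaging, Prop. 2 (53) p.26] -/
theorem hreg_pos_all_of_hsolν_of_numerics_alphaFree (θ₀ : Stage13Params F N) (K : ℕ) (g : ℕ → ℝ)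
    (hεreg : 0 < θ₀.ν.εreg)
    (hε3 : (143 * (((((F.P K).d + 4 : ℕ) : ℝ)) ^ 2 / 4) ^ 2) * θ₀.ν.εreg ≤ 1 / 3)
    (hε2 : 2 * θ₀.ν.εreg ≤ 2 * deltaSU (Fin N) / ((((F.P K).d + 4) * (F.P K).L : ℕ) : ℝ) ^ 2) (hε29 : 0 < θ₀.ε₂₉)
    (hn1 : 1640 * (2 * (((((F.P K).d + 2) * (F.P K).L : ℕ) : ℝ) * θ₀.ε₂₉) +
        ((((F.P K).d + 2) * (F.P K).L : ℕ) : ℝ) ^ 2 / 4 * (2 * θ₀.ν.εreg / ((F.P K).L : ℝ) ^ 2)) * (((F.P K).L : ℝ) ^ ((F.P K).d - 1)) ^ 2 ≤ 1)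
    (hn2 : 13 * (2 * (((((F.P K).d + 2) * (F.P K).L : ℕ) : ℝ) * θ₀.ε₂₉) +
        ((((F.P K).d + 2) * (F.P K).L : ℕ) : ℝ) ^ 2 / 4 * (2 * θ₀.ν.εreg / ((F.P K).L : ℝ) ^ 2)) * ((F.P K).L : ℝ) ^ ((F.P K).d - 1) < deltaSU (Fin N))
    (hord : 2 * θ₀.ν.εreg / ((F.P K).L : ℝ) ^ 2 +
      4 * max θ₀.ε₂₉ (10 * (((((F.P K).d + 2) * (F.P K).L : ℕ) : ℝ) * θ₀.ε₂₉) * ((F.P K).L : ℝ) ^ ((F.P K).d - 1)) ≤ θ₀.ν.ε₀)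
    (hε₀ : 0 ≤ θ₀.ν.ε₀)
    (h24 : ((((F.P K).d + 2) * (F.P K).L : ℕ) : ℝ) ^ 2 / 4 * θ₀.ν.ε₀ < 1 / 24)
    (h64 : 64 * (((((F.P K).d + 2) * (F.P K).L : ℕ) : ℝ) ^ 2 / 4 * θ₀.ν.ε₀) < deltaSU (Fin N))
    (hL : 157 * (((((F.P K).d + 2) * (F.P K).L : ℕ) : ℝ) ^ 2 / 4 * θ₀.ν.ε₀) < ((((F.P K).L : ℝ)) ^ ((F.P K).d - 1))⁻¹)
    (hnumF : ((((F.P K).d * (F.P K).L : ℕ) : ℝ)) ^ 2 / 4 * θ₀.ν.ε₀ < deltaFed (Fin N))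
    (hsolν : ∀ j < K, ∀ W ∈ domAltOfRecord F N θ₀.ν K (j + 1), UkExists F N K (j + 1) θ₀.ν.εreg W)
    (hU : ∀ k, Measurable (Uk F N K (k + 1) θ₀.ν.εreg))
    (hcrit : ∀ j < K, ContinuousOn (critCfgOfRecord F N θ₀.ν K j) (domAltOfRecord F N θ₀.ν K (j + 1))) :
    ∀ j < K, domAltOfRecord F N θ₀.ν K (j + 1) ⊆ regSetOfRecord F N K j
        (betaInputOfRecord F N (TcanOfRecord F N) (chiFixed29 F N θ₀.ν θ₀.ε₂₉) K g j) ∧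
      ∀ V ∈ domAltOfRecord F N θ₀.ν K (j + 1),
        0 < TcanOfRecord F N K j (betaInputOfRecord F N (TcanOfRecord F N) (chiFixed29 F N θ₀.ν θ₀.ε₂₉) K g j) V := by
  obtain ⟨α, hα, hα0, hα24, hα64, -, hαL, hgap⟩ := exists_windowRadius_of_ε₀ (N := N) K hε₀ h24 h64 hL
  exact hreg_pos_all_of_hsolν_of_numerics θ₀ K g hα0 hα24 hα64 hαL hgap hεreg hε3 hε2 hε29 hn1 hn2 hord hα hε₀ hnumF hsolν hU hcrit

section RecordNumerics

variable (θ : Stage13HParams F N) (h : θ.Provisos₁₃SepCoPH F N) {w : WorldP} (P : B12.RunParams)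

/-- ★★★ **N09's THEOREM-3 MEMBER AT THE STAGE-13 RECORD, `α`-FREE**: dag-n09-w5's `thm3Member_stage13SepCoPH_atDomAlt_of_hsolν_of_numerics_of_εreg_eq` (= dag-n09-w4 g3's
door with `hreg` and (I19) discharged down to numerics + `hsolν hcrit hU`) with the six `α`-clauses REPLACED by the three `ε₀`-lines of FILE 1.  Hypotheses: numerics in
`(εreg, ε₂₉, ε₀; d, L, N)`, (181)ˢᵒˡ `hcov`, `hsolν`, N07's `hcrit`, (H-U) `hU`, [B11] ×3 at `εbg` (`h11 hres huniq`), `εreg = εbg`, `hC` — NO auxiliary letter.  CONDITIONAL;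
nothing of Bałaban's estimates asserted; N09 NOT discharged. [cite: Balaban1987RG1, Thm 3 p.264, p.259, (0.4) p.253, (0.17)–(0.19) p.255, (2.9)–(2.10) pp.266–267; Balaban1985Variational, Thm 1 (8)–(10) p.279 and (181) p.307; Balaban1985Averaging, Prop. 2 (53) p.26 and Prop. 3 (124) p.36] -/
theorem thm3Member_stage13SepCoPH_atDomAlt_of_hsolν_of_numerics_of_εreg_eq_alphaFree
    (hC : w.C = (datumOfRecord₁₃SepCoPH F N θ h).C) (heq : θ.toStage13Params.ν.εreg = θ.εbg)
    (hεreg : 0 < θ.toStage13Params.ν.εreg)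
    (hε3 : (143 * (((((F.P P.K).d + 4 : ℕ) : ℝ)) ^ 2 / 4) ^ 2) * θ.toStage13Params.ν.εreg ≤ 1 / 3)
    (hε2 : 2 * θ.toStage13Params.ν.εreg ≤ 2 * deltaSU (Fin N) / ((((F.P P.K).d + 4) * (F.P P.K).L : ℕ) : ℝ) ^ 2) (hε29 : 0 < θ.toStage13Params.ε₂₉)
    (hn1 : 1640 * (2 * (((((F.P P.K).d + 2) * (F.P P.K).L : ℕ) : ℝ) * θ.toStage13Params.ε₂₉) +
        ((((F.P P.K).d + 2) * (F.P P.K).L : ℕ) : ℝ) ^ 2 / 4 * (2 * θ.toStage13Params.ν.εreg / ((F.P P.K).L : ℝ) ^ 2)) * (((F.P P.K).L : ℝ) ^ ((F.P P.K).d - 1)) ^ 2 ≤ 1)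
    (hn2 : 13 * (2 * (((((F.P P.K).d + 2) * (F.P P.K).L : ℕ) : ℝ) * θ.toStage13Params.ε₂₉) +
        ((((F.P P.K).d + 2) * (F.P P.K).L : ℕ) : ℝ) ^ 2 / 4 * (2 * θ.toStage13Params.ν.εreg / ((F.P P.K).L : ℝ) ^ 2)) * ((F.P P.K).L : ℝ) ^ ((F.P P.K).d - 1) < deltaSU (Fin N))
    (hord : 2 * θ.toStage13Params.ν.εreg / ((F.P P.K).L : ℝ) ^ 2 +
      4 * max θ.toStage13Params.ε₂₉ (10 * (((((F.P P.K).d + 2) * (F.P P.K).L : ℕ) : ℝ) * θ.toStage13Params.ε₂₉) * ((F.P P.K).L : ℝ) ^ ((F.P P.K).d - 1)) ≤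
        θ.toStage13Params.ν.ε₀)
    (hε₀ : 0 ≤ θ.toStage13Params.ν.ε₀)
    (h24 : ((((F.P P.K).d + 2) * (F.P P.K).L : ℕ) : ℝ) ^ 2 / 4 * θ.toStage13Params.ν.ε₀ < 1 / 24)
    (h64 : 64 * (((((F.P P.K).d + 2) * (F.P P.K).L : ℕ) : ℝ) ^ 2 / 4 * θ.toStage13Params.ν.ε₀) < deltaSU (Fin N))
    (hL : 157 * (((((F.P P.K).d + 2) * (F.P P.K).L : ℕ) : ℝ) ^ 2 / 4 * θ.toStage13Params.ν.ε₀) < ((((F.P P.K).L : ℝ)) ^ ((F.P P.K).d - 1))⁻¹)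
    (hnumF : ((((F.P P.K).d * (F.P P.K).L : ℕ) : ℝ)) ^ 2 / 4 * θ.toStage13Params.ν.ε₀ < deltaFed (Fin N))
    (hcov : ∀ j < P.K, ∀ (v : GaugeTransf (F.P P.K) (j + 1) (SU N)) (W : GaugeField (F.P P.K) (j + 1) (SU N)),
      UkExists F N P.K (j + 1) θ.toStage13Params.ν.εreg W →
        critCfgOfRecord F N θ.toStage13Params.ν P.K j (gaugeAct v W) = gaugeAct (liftTransf v) (critCfgOfRecord F N θ.toStage13Params.ν P.K j W))
    (hsolν : ∀ j < P.K, ∀ W ∈ domAltOfRecord F N θ.ν P.K (j + 1), UkExists F N P.K (j + 1) θ.toStage13Params.ν.εreg W)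
    (hU : ∀ k, Measurable (Uk F N P.K (k + 1) θ.toStage13Params.ν.εreg))
    (hcrit : ∀ j < P.K, ContinuousOn (critCfgOfRecord F N θ.toStage13Params.ν P.K j) (domAltOfRecord F N θ.ν P.K (j + 1)))
    (h11 : ∀ k, k ≤ P.K → ∀ V ∈ domAltOfRecord F N θ.ν P.K k, UkExists F N P.K k θ.εbg V ∧ UniqueUkOrbit F N P.K k θ.εbg V)
    (hres : ∀ k, k ≤ P.K → HRestrict F N θ.εbg P.K k (domAltOfRecord F N θ.ν P.K k))
    (huniq : ∀ k, k ≤ P.K → ∀ V ∈ domAltOfRecord F N θ.ν P.K k, ∀ j < k,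
      UniqueUkOrbit F N P.K (j + 1) θ.εbg (Averaging.iter (avOfRecord F N P.K) (j + 1) (Uk F N P.K k θ.εbg V))) :
    (leavesP w P).smallCouplings → (leavesP w P).smallFieldInductive := by
  obtain ⟨α, hα, hα0, hα24, hα64, -, hαL, hgap⟩ := exists_windowRadius_of_ε₀ (N := N) P.K hε₀ h24 h64 hL
  exact thm3Member_stage13SepCoPH_atDomAlt_of_hsolν_of_numerics_of_εreg_eq θ h P hC heq hα0 hα24 hα64 hαL hgap hεreg hε3 hε2 hε29 hn1 hn2 hord hα hε₀ hnumF
    hcov hsolν hU hcrit h11 hres huniq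

/-- ★★★ **N09's THEOREM-3 MEMBER AT THE STAGE-13 RECORD, TWO RADII, `α`-FREE, `hsolν`-FREE, (I19)-FREE**: dag-n09-w4 g3's TWO-RADII door
`…N09B0RiderAtRecord.thm3Member_stage13SepCoPH_atDomAlt_of_thm1_of_reg8_of_numerics` (`εreg ≤ εbg` + [B11] Thm 1 (8)-membership `hreg8` instead of `εreg = εbg`) with `hreg`
:= the `α`-free tower (`hreg_pos_all_of_hsolν_of_numerics_alphaFree`), its [B11]-existence input `hsolν` at `εreg` DERIVED from `h11` at `εbg` + `hreg8` + `εreg ≤ εbg`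
(dag-n09-w1 g2's `…N09BackgroundRadiiTransfer.ukExists_εreg_of_h11_of_reg8`), and (I19) `hint` DERIVED from (H-U) `hU` (dag-n24-c's `integrable_betaInput_stage13_of_measurableUk`).
Hypotheses: numerics in `(εreg, ε₂₉, ε₀; d, L, N)`, `εreg ≤ εbg`, `hreg8`, (181)ˢᵒˡ `hcov`, N07's `hcrit`, (H-U) `hU`, [B11] ×3 at `εbg` (`h11 hres huniq`), `hC` — NO `α`, NO
`hsolν`, NO `hint`, NO `hreg`.  CONDITIONAL; nothing of Bałaban's estimates asserted; N09 NOT discharged. [cite: Balaban1987RG1, Thm 3 p.264, p.259, (0.4) p.253, (0.17)–(0.19) p.255, (2.9)–(2.10) pp.266–267; Balaban1985Variational, Thm 1 (8)–(10) p.279 and (181) p.307; Balaban1985Averaging, Prop. 2 (53) p.26 and Prop. 3 (124) p.36] -/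
theorem thm3Member_stage13SepCoPH_atDomAlt_of_thm1_of_reg8_of_numerics_alphaFree
    (hC : w.C = (datumOfRecord₁₃SepCoPH F N θ h).C)
    (hreg8 : ∀ k, k ≤ P.K → ∀ V ∈ domAltOfRecord F N θ.ν P.K k, Uk F N P.K k θ.εbg V ∈ bgReg F N P.K k θ.toStage13Params.ν.εreg)
    (hle : θ.toStage13Params.ν.εreg ≤ θ.εbg) (hεreg : 0 < θ.toStage13Params.ν.εreg)
    (hε3 : (143 * (((((F.P P.K).d + 4 : ℕ) : ℝ)) ^ 2 / 4) ^ 2) * θ.toStage13Params.ν.εreg ≤ 1 / 3)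
    (hε2 : 2 * θ.toStage13Params.ν.εreg ≤ 2 * deltaSU (Fin N) / ((((F.P P.K).d + 4) * (F.P P.K).L : ℕ) : ℝ) ^ 2) (hε29 : 0 < θ.toStage13Params.ε₂₉)
    (hn1 : 1640 * (2 * (((((F.P P.K).d + 2) * (F.P P.K).L : ℕ) : ℝ) * θ.toStage13Params.ε₂₉) +
        ((((F.P P.K).d + 2) * (F.P P.K).L : ℕ) : ℝ) ^ 2 / 4 * (2 * θ.toStage13Params.ν.εreg / ((F.P P.K).L : ℝ) ^ 2)) * (((F.P P.K).L : ℝ) ^ ((F.P P.K).d - 1)) ^ 2 ≤ 1)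
    (hn2 : 13 * (2 * (((((F.P P.K).d + 2) * (F.P P.K).L : ℕ) : ℝ) * θ.toStage13Params.ε₂₉) +
        ((((F.P P.K).d + 2) * (F.P P.K).L : ℕ) : ℝ) ^ 2 / 4 * (2 * θ.toStage13Params.ν.εreg / ((F.P P.K).L : ℝ) ^ 2)) * ((F.P P.K).L : ℝ) ^ ((F.P P.K).d - 1) < deltaSU (Fin N))
    (hord : 2 * θ.toStage13Params.ν.εreg / ((F.P P.K).L : ℝ) ^ 2 +
      4 * max θ.toStage13Params.ε₂₉ (10 * (((((F.P P.K).d + 2) * (F.P P.K).L : ℕ) : ℝ) * θ.toStage13Params.ε₂₉) * ((F.P P.K).L : ℝ) ^ ((F.P P.K).d - 1)) ≤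
        θ.toStage13Params.ν.ε₀)
    (hε₀ : 0 ≤ θ.toStage13Params.ν.ε₀)
    (h24 : ((((F.P P.K).d + 2) * (F.P P.K).L : ℕ) : ℝ) ^ 2 / 4 * θ.toStage13Params.ν.ε₀ < 1 / 24)
    (h64 : 64 * (((((F.P P.K).d + 2) * (F.P P.K).L : ℕ) : ℝ) ^ 2 / 4 * θ.toStage13Params.ν.ε₀) < deltaSU (Fin N))
    (hL : 157 * (((((F.P P.K).d + 2) * (F.P P.K).L : ℕ) : ℝ) ^ 2 / 4 * θ.toStage13Params.ν.ε₀) < ((((F.P P.K).L : ℝ)) ^ ((F.P P.K).d - 1))⁻¹)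
    (hnumF : ((((F.P P.K).d * (F.P P.K).L : ℕ) : ℝ)) ^ 2 / 4 * θ.toStage13Params.ν.ε₀ < deltaFed (Fin N))
    (hcov : ∀ j < P.K, ∀ (v : GaugeTransf (F.P P.K) (j + 1) (SU N)) (W : GaugeField (F.P P.K) (j + 1) (SU N)),
      UkExists F N P.K (j + 1) θ.toStage13Params.ν.εreg W →
        critCfgOfRecord F N θ.toStage13Params.ν P.K j (gaugeAct v W) = gaugeAct (liftTransf v) (critCfgOfRecord F N θ.toStage13Params.ν P.K j W))
    (hU : ∀ k, Measurable (Uk F N P.K (k + 1) θ.toStage13Params.ν.εreg))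
    (hcrit : ∀ j < P.K, ContinuousOn (critCfgOfRecord F N θ.toStage13Params.ν P.K j) (domAltOfRecord F N θ.ν P.K (j + 1)))
    (h11 : ∀ k, k ≤ P.K → ∀ V ∈ domAltOfRecord F N θ.ν P.K k, UkExists F N P.K k θ.εbg V ∧ UniqueUkOrbit F N P.K k θ.εbg V)
    (hres : ∀ k, k ≤ P.K → HRestrict F N θ.εbg P.K k (domAltOfRecord F N θ.ν P.K k))
    (huniq : ∀ k, k ≤ P.K → ∀ V ∈ domAltOfRecord F N θ.ν P.K k, ∀ j < k,
      UniqueUkOrbit F N P.K (j + 1) θ.εbg (Averaging.iter (avOfRecord F N P.K) (j + 1) (Uk F N P.K k θ.εbg V))) :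
    (leavesP w P).smallCouplings → (leavesP w P).smallFieldInductive := by
  have hsolν : ∀ j < P.K, ∀ W ∈ domAltOfRecord F N θ.ν P.K (j + 1), UkExists F N P.K (j + 1) θ.toStage13Params.ν.εreg W :=
    ukExists_εreg_of_h11_of_reg8 θ.toStage13Params.ν θ.εbg P.K h11 hreg8 hle
  obtain ⟨α, hα, hα0, hα24, hα64, -, hαL, hgap⟩ := exists_windowRadius_of_ε₀ (N := N) P.K hε₀ h24 h64 hL
  exact thm3Member_stage13SepCoPH_atDomAlt_of_thm1_of_reg8_of_numerics θ h hC P hε29 hreg8 hle hεreg hε3 hε2 hn1 hn2 hord hcov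
    (integrable_betaInput_stage13_of_measurableUk θ.toStage13Params P fun k _ => hU k)
    (fun j hj => (hreg_pos_all_of_hsolν_of_numerics θ.toStage13Params P.K (gOfRecord₁₃ F N θ.toStage13Params P) hα0 hα24 hα64 hαL hgap
      hεreg hε3 hε2 hε29 hn1 hn2 hord hα hε₀ hnumF hsolν hU hcrit j hj).1)
    h11 hres huniq

end RecordNumerics

end Summit.QuantumFields.YangMills.BalabanUVNodes.N09TowerOfNumericsAlphaFree

end
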